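import Summits.Ventures.CertifiedManyBodySolver.Observables.StiffnessKinematicLeaf
import Summits.Ventures.CertifiedManyBodySolver.Observables.DoccHoppingURayTTPrime
import HarnessLib

/-!
# Ventures/CertifiedManyBodySolver — Observables/DoccCeilingOfKineticCeiling.lean

HONEST FRAMING: a DERIVED one-sided CEILING on the site double occupancy of torus-limit ground states (a CONTROL observable), read
off a certified KINETIC ceiling and a certified energy CAP at zero compute; a docc ceiling is a control, never pairing progress, never a
stiffness statement by itself; not informative vs print; not a superconductivity verdict; zero compute; no definition, no claim node,
no `sorry`.

Cell `hubbard-obs` (D-0042), seat p2 (stiffness), `prover-hubbard-obs-p2-g15-0`. The converse reading of the `t′ = 0` identity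
`k(ω) = e₀(U, n, 0) − U·D(ω)` of `Observables/StiffnessKinematicLeaf.lean` (`torusLimit_kineticDensity_eq_energy_sub_docc`, p2 g9): that
file turns a docc FLOOR plus the cap into a kinetic FLOOR (`torusLimit_negKinetic_ge_of_doccFloor_of_cap`, registry row 26 / 34 class);
this file turns a kinetic CEILING plus the cap into a docc CEILING:

* §1 `torusLimit_docc_le_of_negKinetic_le_of_cap` (`U > 0`, `0 ≤ n < 2`, `t′ = 0`): if `e₀(U, n, 0) ≤ hi` and `−k(ω) ≤ X` for every torus
  limit `ω` of unit `(rectN n L, S^z = 0)`-sector ground states of `hubbardTorusTT' L 1 0 U`, then `D(ω) = Re ω(n_{0↑}n_{0↓}) ≤ (hi + X)/U` for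
  every such `ω` (`U·D(ω) = e₀ − k(ω) ≤ hi + X`).
* §2 `forall_torusLimit_docc_le_on_ray_of_negKinetic_le_of_cap`: the same ceiling holds at every coupling `U′ ≥ U` on the `(n, 0)` ray
  (double occupancy non-increasing in `U`, `forall_torusLimit_docc_le_of_le_coupling`, Griffiths / Koma–Tasaki).

WHY (the operational content, stated once): on any relaxation host carrying the energy row as the exact linear identity `e = k + U·d` among its
variables, the kinetic edge `max(−k)` and the docc edge `max d` under the same cap `e ≤ hi` are ONE vertex whenever the cap binds at the
optimum (`κ_hi > 0`): `max(−k) = U·max d − hi`. Hence every certified anchor-level KINETIC ceiling is at the same time a certified DOCC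
ceiling `(hi + X)/U`, and at a `t′ = 0` anchor the burst's per-anchor menu needs ONE of the two solves, not both. Instance of record:
`Certificates/HubbardSquare_n7o8_docc_derivedCeiling_kinlo.lean` (A0′ = (8, 7/8, 0): the EXT5-L⁺ kinlo row ⇒ `d ≤ 0.0797234`, tighter than the
T2 CONTROL up-edge `0.0925538`). What does NOT follow: anything at `t′ ≠ 0` from an f-sum STIFFNESS edge (the functional `−¼(K₁ + 2t′K₂)` is
not the hopping energy), a docc FLOOR from a kinetic floor without the energy floor (that is `torusLimit_negKinetic_ge_of_doccFloor_of_cap`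
read backwards: `D ≥ (lo + X_lo)/U` needs the LOWER energy row — stated in §1 as `torusLimit_le_docc_of_le_negKinetic_of_floor`).

References: [KomaTasaki1994] T. Koma, H. Tasaki, J. Stat. Phys. 76 (1994) 745, §1; [Griffiths1966] R. B. Griffiths, J. Math. Phys. 7
(1966), §II; [BratteliRobinsonII1997] O. Bratteli, D. W. Robinson II (1997) §6.2.4.
-/

noncomputable section

namespace Summit.Ventures.CertifiedManyBodySolver.Observables

open Matrix Finset Filter Topology
open Literature.MathematicalPhysics.QuantumLattice
open Literature.MathematicalPhysics.QuantumLattice.ThermodynamicLimit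
open Literature.Probability.LatticeModels
open scoped ComplexOrder ComplexConjugate Topology BigOperators

/-! ## §1 Docc ceiling from a kinetic ceiling and the cap; docc floor from a kinetic floor and the energy floor -/

/-- **Derived docc CEILING `D(ω) ≤ (hi + X)/U`** at a generic anchor `(U, n, 0)` (`U > 0`, `0 ≤ n < 2`): a certified cap `e₀(U, n, 0) ≤ hi` and a
certified kinetic ceiling `−k(ω) ≤ X` on the torus-limit ground-state class give `Re ω(n_{0↑}n_{0↓}) ≤ (hi + X)/U` for every state of the class,
because `U·D(ω) = e₀ − k(ω)` (`torusLimit_kineticDensity_eq_energy_sub_docc`). A docc ceiling is a CONTROL, not a stiffness statement.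
[cite: KomaTasaki1994, §1] [cite: BratteliRobinsonII1997, §6.2.4] -/
theorem torusLimit_docc_le_of_negKinetic_le_of_cap {U n : ℝ} (hU : 0 < U) (hn0 : 0 ≤ n) (hn2 : n < 2) {hi : ℚ} {X : ℝ}
    (hcap : energyDensityTT' 1 0 U n ≤ ((hi : ℚ) : ℝ))
    (hX : ∀ (ω : InfVolFermionState 2) (Ls : ℕ → ℕ) (ψ : ∀ L, Fock (Orb (FermionTorus 2 L))),
      Tendsto Ls atTop atTop →
      (∀ j, IsGroundStateInSector (hubbardTorusTT' (Ls j) 1 0 U) (rectN n (Ls j)) 0 (ψ (Ls j))) →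
      (∀ j, star (ψ (Ls j)) ⬝ᵥ ψ (Ls j) = 1) → ω.IsTorusLimitOf ψ Ls →
      -(∑ i : Fin 2, -(1 : ℝ) * ∑ σ : Fin 2,
          ((ω.expect {0, 0 + unitVec i}
              ((cAt 0 (mem_insert_self _ _) σ)ᴴ * cAt (0 + unitVec i) (mem_insert_of_mem (mem_singleton_self _)) σ)).re +
            (ω.expect {0, 0 + unitVec i}
              ((cAt (0 + unitVec i) (mem_insert_of_mem (mem_singleton_self _)) σ)ᴴ * cAt 0 (mem_insert_self _ _) σ)).re)) ≤ X) :
    ∀ (ω : InfVolFermionState 2) (Ls : ℕ → ℕ) (ψ : ∀ L, Fock (Orb (FermionTorus 2 L))),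
      Tendsto Ls atTop atTop →
      (∀ j, IsGroundStateInSector (hubbardTorusTT' (Ls j) 1 0 U) (rectN n (Ls j)) 0 (ψ (Ls j))) →
      (∀ j, star (ψ (Ls j)) ⬝ᵥ ψ (Ls j) = 1) → ω.IsTorusLimitOf ψ Ls →
      (ω.expect ({0} : Finset (Site 2)) (doccAt0 2)).re ≤ (((hi : ℚ) : ℝ) + X) / U := by
  intro ω Ls ψ hLs hψ h1 hω
  have hk := torusLimit_kineticDensity_eq_energy_sub_docc hU.le hn0 hn2 ω Ls ψ hLs hψ h1 hω
  have hXω := hX ω Ls ψ hLs hψ h1 hω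
  rw [hk] at hXω
  rw [le_div_iff₀ hU]
  linarith

/-- **Derived docc FLOOR `(lo + Y)/U ≤ D(ω)`** at a generic anchor `(U, n, 0)` (`U > 0`, `0 ≤ n < 2`): a certified energy FLOOR `lo ≤ e₀(U, n, 0)`
and a certified kinetic-magnitude FLOOR `Y ≤ −k(ω)` on the torus-limit ground-state class give `(lo + Y)/U ≤ Re ω(n_{0↑}n_{0↓})` for every state of
the class (`U·D(ω) = e₀ − k(ω) ≥ lo + Y`). Recorded for completeness (the mirror of §1); at today's anchors the direct docc lo edges are tighter,
since the certified kinetic floors are themselves derived from docc floors. [cite: KomaTasaki1994, §1] -/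
theorem torusLimit_le_docc_of_le_negKinetic_of_floor {U n : ℝ} (hU : 0 < U) (hn0 : 0 ≤ n) (hn2 : n < 2) {lo : ℚ} {Y : ℝ}
    (hfloor : ((lo : ℚ) : ℝ) ≤ energyDensityTT' 1 0 U n)
    (hY : ∀ (ω : InfVolFermionState 2) (Ls : ℕ → ℕ) (ψ : ∀ L, Fock (Orb (FermionTorus 2 L))),
      Tendsto Ls atTop atTop →
      (∀ j, IsGroundStateInSector (hubbardTorusTT' (Ls j) 1 0 U) (rectN n (Ls j)) 0 (ψ (Ls j))) →
      (∀ j, star (ψ (Ls j)) ⬝ᵥ ψ (Ls j) = 1) → ω.IsTorusLimitOf ψ Ls →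
      Y ≤ -(∑ i : Fin 2, -(1 : ℝ) * ∑ σ : Fin 2,
          ((ω.expect {0, 0 + unitVec i}
              ((cAt 0 (mem_insert_self _ _) σ)ᴴ * cAt (0 + unitVec i) (mem_insert_of_mem (mem_singleton_self _)) σ)).re +
            (ω.expect {0, 0 + unitVec i}
              ((cAt (0 + unitVec i) (mem_insert_of_mem (mem_singleton_self _)) σ)ᴴ * cAt 0 (mem_insert_self _ _) σ)).re))) :
    ∀ (ω : InfVolFermionState 2) (Ls : ℕ → ℕ) (ψ : ∀ L, Fock (Orb (FermionTorus 2 L))),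
      Tendsto Ls atTop atTop →
      (∀ j, IsGroundStateInSector (hubbardTorusTT' (Ls j) 1 0 U) (rectN n (Ls j)) 0 (ψ (Ls j))) →
      (∀ j, star (ψ (Ls j)) ⬝ᵥ ψ (Ls j) = 1) → ω.IsTorusLimitOf ψ Ls →
      ((((lo : ℚ) : ℝ) + Y) / U ≤ (ω.expect ({0} : Finset (Site 2)) (doccAt0 2)).re) := by
  intro ω Ls ψ hLs hψ h1 hω
  have hk := torusLimit_kineticDensity_eq_energy_sub_docc hU.le hn0 hn2 ω Ls ψ hLs hψ h1 hω
  have hYω := hY ω Ls ψ hLs hψ h1 hω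
  rw [hk] at hYω
  rw [div_le_iff₀ hU]
  linarith

/-! ## §2 Transport up the `(n, 0)` ray (double occupancy non-increasing in `U`) -/

/-- **The derived docc ceiling holds on the whole half-line `U′ ≥ U`**: under the hypotheses of `torusLimit_docc_le_of_negKinetic_le_of_cap` at
the anchor `(U, n, 0)`, `Re ω′(n_{0↑}n_{0↓}) ≤ (hi + X)/U` for every torus limit `ω′` of unit sector ground states at ANY coupling `U′ ≥ U` on the
`(n, 0)` ray (`forall_torusLimit_docc_le_of_le_coupling`: the double occupancy is non-increasing in `U` across the torus-limit classes).
[cite: Griffiths1966, §II] [cite: KomaTasaki1994, §1] -/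
theorem forall_torusLimit_docc_le_on_ray_of_negKinetic_le_of_cap {U n : ℝ} (hU : 0 < U) (hn0 : 0 ≤ n) (hn2 : n < 2) {hi : ℚ} {X : ℝ}
    (hcap : energyDensityTT' 1 0 U n ≤ ((hi : ℚ) : ℝ))
    (hX : ∀ (ω : InfVolFermionState 2) (Ls : ℕ → ℕ) (ψ : ∀ L, Fock (Orb (FermionTorus 2 L))),
      Tendsto Ls atTop atTop →
      (∀ j, IsGroundStateInSector (hubbardTorusTT' (Ls j) 1 0 U) (rectN n (Ls j)) 0 (ψ (Ls j))) →
      (∀ j, star (ψ (Ls j)) ⬝ᵥ ψ (Ls j) = 1) → ω.IsTorusLimitOf ψ Ls →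
      -(∑ i : Fin 2, -(1 : ℝ) * ∑ σ : Fin 2,
          ((ω.expect {0, 0 + unitVec i}
              ((cAt 0 (mem_insert_self _ _) σ)ᴴ * cAt (0 + unitVec i) (mem_insert_of_mem (mem_singleton_self _)) σ)).re +
            (ω.expect {0, 0 + unitVec i}
              ((cAt (0 + unitVec i) (mem_insert_of_mem (mem_singleton_self _)) σ)ᴴ * cAt 0 (mem_insert_self _ _) σ)).re)) ≤ X)
    {U' : ℝ} (hU' : U ≤ U') :
    ∀ (ω : InfVolFermionState 2) (Ls : ℕ → ℕ) (ψ : ∀ L, Fock (Orb (FermionTorus 2 L))),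
      Tendsto Ls atTop atTop →
      (∀ j, IsGroundStateInSector (hubbardTorusTT' (Ls j) 1 0 U') (rectN n (Ls j)) 0 (ψ (Ls j))) →
      (∀ j, star (ψ (Ls j)) ⬝ᵥ ψ (Ls j) = 1) → ω.IsTorusLimitOf ψ Ls →
      (ω.expect ({0} : Finset (Site 2)) (doccAt0 2)).re ≤ (((hi : ℚ) : ℝ) + X) / U :=
  forall_torusLimit_docc_le_of_le_coupling 0 (U₀ := U) hU.le hU' hn0 hn2
    (torusLimit_docc_le_of_negKinetic_le_of_cap hU hn0 hn2 hcap hX)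

end Summit.Ventures.CertifiedManyBodySolver.Observables
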